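import Summits.CriticalPhenomena.PercolationContinuityZ3.Theorems.PercNearOneGluingNoHeavyQuantGateMoveBlobRates
import HarnessLib

/-!
# QUANT lane R8, T-DEC: THE TRANSFER OF A FLOW TO A LOWER TARGET — a flow witness of `Λ` at `(x, τ, j, M)` restricted to the nonzero
# lows of a second law `P` at a target `t ≤ τ` (rows scaled by `P l / Λ l ≤ 1`) is a partial routing of `P`'s nonzero lows whose column
# loads at the `t`-rates are at most the `τ`-loads of `Λ` (`LawDec.transfer_partialRouting`) — the input of `flowAtT_of_offers/income`

builds on p205010 (kernel theorem, internal audit signed; external expert review pending)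

Support file (`--supports stmt-CriticalPhenomena-4575`), QUANT lane seat prim-quant-arm-1 (gen 39), rung R8 of
`run/shared/lean/prim/quant/LADDER.md`.  Theorems only (no definitions), standard axioms, no sorries.  Uses typer g27's rate monotonicity
(`usage_le_of_rho_le`, `rho_le_of_target_le`, `…QuantGateMoveBlobRates`) and `usage_giant_eq`, `usage_pos_of_compat`.
WHY (TWIN-MOVE-G39 §4–§5): the primal route to `LawDec.TwinMoveDEC` / the move lemma (M) for general `a` transfers a (normal-form) flow of
`Λ = slice ν a g` at `τ` to `P = Λ + gz(δ₀ − δ_a)` at `t = τ − zag` and finishes with the income criterion (`…QuantIncomeCriterion`); lead g29's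
(MT-R) primal likewise transfers the flow of `R_a ν` from its own target down to the mixture target.  This file is the generic bookkeeping step:
compatibility only widens and usage rates only drop when the target drops (same floor, same layer), so the restricted, row-scaled flow routes
every nonzero `t`-low of `P` exactly and loads every column by at most what `Λ`'s flow loaded it with at `τ`.  What it does NOT do: compare
those loads with `P`'s capacities (at an atom where `P < Λ`, e.g. the blob atom `a`, the caller must re-route the excess) — that and the budget
inequality are the remaining mathematics.

* **`LawDec.transfer_partialRouting`** — `0 < x < 1`, `t ≤ τ`, `f` a flow witness of `Λ` at `(x, τ, j, M)`, and `0 ≤ P l ≤ Λ l` on the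
  nonzero `t`-lows.  Then `φ l h := [1 ≤ l, 2l < t]·(P l / Λ l)·f l h` satisfies: `φ ≥ 0`; charged pairs are (nonzero `t`-low `l ≤ j`,
  absorber `h ≤ M`, giant or `t < l + h`); `Σ_h φ l h = P l` on the nonzero `t`-lows; and for every `h ≤ M`,
  `Σ_l usage x t j l h·φ l h ≤ Σ_l usage x τ j l h·f l h` (hence `≤ Λ h` on `τ`-absorbers).

[this work]; rate monotonicity: prim-quant-stmt g27 (this lane).  Nothing here is cited as a published result.  The gluing rows served
[cite: KozmaNitzan2024, Conjecture 3 (p. 15)]; product measure [cite: Grimmett1999, §1.3 p. 10].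
-/

noncomputable section

namespace Summit.CriticalPhenomena.PercolationContinuityZ3.Theorems

namespace Quant

open Finset

namespace LawDec

/-- **TRANSFER OF A FLOW WITNESS TO A LOWER TARGET.**  See the module docstring. [this work] -/
theorem transfer_partialRouting (x t τ : ℝ) (j M : ℕ) (Λ P : ℕ → ℝ) (f : ℕ → ℕ → ℝ) (hx0 : 0 < x) (hx1 : x < 1)
    (htτ : t ≤ τ) (hf : IsFlowAtT x τ j M Λ f)
    (hrows : ∀ l : ℕ, 1 ≤ l → l ≤ j → 2 * (l : ℝ) < t → 0 ≤ P l ∧ P l ≤ Λ l) :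
    (∀ l h : ℕ, 0 ≤ (if (1 ≤ l ∧ 2 * (l : ℝ) < t) then P l / Λ l * f l h else 0)) ∧
    (∀ l h : ℕ, 0 < (if (1 ≤ l ∧ 2 * (l : ℝ) < t) then P l / Λ l * f l h else 0) →
      (1 ≤ l ∧ l ≤ j ∧ 2 * (l : ℝ) < t) ∧ h ≤ M ∧ (j + 1 ≤ h ∨ t < (l : ℝ) + h)) ∧
    (∀ l : ℕ, 1 ≤ l → l ≤ j → 2 * (l : ℝ) < t →
      ∑ h ∈ Finset.range (M + 1), (if (1 ≤ l ∧ 2 * (l : ℝ) < t) then P l / Λ l * f l h else 0) = P l) ∧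
    (∀ h : ℕ, h ≤ M →
      ∑ l ∈ Finset.range (j + 1), usage x t j l h * (if (1 ≤ l ∧ 2 * (l : ℝ) < t) then P l / Λ l * f l h else 0)
        ≤ ∑ l ∈ Finset.range (j + 1), usage x τ j l h * f l h) := by
  classical
  obtain ⟨hf0, hsupp, hrow, hcol⟩ := hf
  -- the row scale is in `[0, 1]`
  have hθ : ∀ l : ℕ, 1 ≤ l → l ≤ j → 2 * (l : ℝ) < t → 0 ≤ P l / Λ l ∧ P l / Λ l ≤ 1 := by
    intro l h1 hlj hlow
    obtain ⟨hP0, hPΛ⟩ := hrows l h1 hlj hlow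
    rcases lt_or_ge 0 (Λ l) with hΛ | hΛ
    · exact ⟨div_nonneg hP0 hΛ.le, (div_le_one hΛ).2 hPΛ⟩
    · have hP : P l = 0 := le_antisymm (hPΛ.trans hΛ) hP0
      rw [hP, zero_div]; exact ⟨le_rfl, zero_le_one⟩
  -- a charged pair of `f` out of a nonzero `t`-low: facts
  have hpair : ∀ l h : ℕ, 1 ≤ l → 2 * (l : ℝ) < t → 0 < f l h →
      l ≤ j ∧ 2 * (l : ℝ) < τ ∧ h ≤ M ∧ (j + 1 ≤ h ∨ τ < (l : ℝ) + h) ∧ l < h := by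
    intro l h h1 hlow hp
    obtain ⟨hlj, hl2, hhM, hc⟩ := hsupp l h hp
    refine ⟨hlj, hl2, hhM, hc, ?_⟩
    rcases hc with hc | hc
    · omega
    · have : (l : ℝ) < h := by linarith
      exact_mod_cast this
  refine ⟨fun l h => ?_, fun l h hp => ?_, fun l h1 hlj hlow => ?_, fun h hhM => ?_⟩
  · -- nonnegativity
    split_ifs with hc
    · rcases (hf0 l h).eq_or_lt with hz | hp
      · rw [← hz, mul_zero]
      · obtain ⟨hlj, _, _, _, _⟩ := hpair l h hc.1 hc.2 hp
        exact mul_nonneg (hθ l hc.1 hlj hc.2).1 (hf0 l h)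
    · exact le_rfl
  · -- charged pairs
    by_cases hc : (1 ≤ l ∧ 2 * (l : ℝ) < t)
    · rw [if_pos hc] at hp
      have hfp : 0 < f l h := by
        rcases (hf0 l h).eq_or_lt with hz | hfp
        · rw [← hz, mul_zero] at hp; exact absurd hp (lt_irrefl 0)
        · exact hfp
      obtain ⟨hlj, _, hhM, hcomp, _⟩ := hpair l h hc.1 hc.2 hfp
      refine ⟨⟨hc.1, hlj, hc.2⟩, hhM, ?_⟩
      rcases hcomp with h1 | h2
      · exact Or.inl h1
      · exact Or.inr (lt_of_le_of_lt htτ h2)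
    · rw [if_neg hc] at hp; exact absurd hp (lt_irrefl 0)
  · -- rows
    simp only [if_pos (show (1 ≤ l ∧ 2 * (l : ℝ) < t) from ⟨h1, hlow⟩)]
    rw [← Finset.mul_sum, hrow l hlj (by linarith)]
    obtain ⟨hP0, hPΛ⟩ := hrows l h1 hlj hlow
    rcases lt_or_ge 0 (Λ l) with hΛ | hΛ
    · field_simp
    · have hP : P l = 0 := le_antisymm (hPΛ.trans hΛ) hP0
      have hΛ0 : Λ l = 0 := by
        -- the row of `l` sums to `Λ l ≥ 0`
        have : 0 ≤ Λ l := by rw [← hrow l hlj (by linarith)]; exact Finset.sum_nonneg fun h _ => hf0 l h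
        linarith
      rw [hP, hΛ0]; simp
  · -- columns: termwise `usage_t·θ·f ≤ usage_τ·f`
    refine Finset.sum_le_sum fun l hl => ?_
    have hlj : l ≤ j := by have := Finset.mem_range.1 hl; omega
    by_cases hc : (1 ≤ l ∧ 2 * (l : ℝ) < t)
    · rw [if_pos hc]
      rcases (hf0 l h).eq_or_lt with hz | hfp
      · rw [← hz, mul_zero, mul_zero, mul_zero]
      · obtain ⟨_, hl2, _, hcomp, hlh⟩ := hpair l h hc.1 hc.2 hfp
        have hcompt : j + 1 ≤ h ∨ t < (l : ℝ) + h := by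
          rcases hcomp with h1 | h2
          · exact Or.inl h1
          · exact Or.inr (lt_of_le_of_lt htτ h2)
        have hut0 : 0 ≤ usage x t j l h := (usage_pos_of_compat x t j l h hx0 hx1 hc.2 hlh hcompt).le
        -- `usage_t ≤ usage_τ`
        have hmono : usage x t j l h ≤ usage x τ j l h := by
          by_cases hg : j + 1 ≤ h
          · rw [usage_giant_eq x t j l h hg, usage_giant_eq x τ j l h hg]
          · have hhj : h ≤ j := by omega
            have hcomp' : τ < (l : ℝ) + h := hcomp.resolve_left hg
            exact usage_le_of_rho_le x t τ j l l h hx0 hx1 hhj hl2 hcomp' (rho_le_of_target_le t τ l h hlh htτ)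
        have hθ1 := (hθ l hc.1 hlj hc.2).2
        have hθ0 := (hθ l hc.1 hlj hc.2).1
        calc usage x t j l h * (P l / Λ l * f l h)
            = (usage x t j l h * (P l / Λ l)) * f l h := by ring
          _ ≤ (usage x τ j l h * 1) * f l h :=
              mul_le_mul_of_nonneg_right (mul_le_mul hmono hθ1 hθ0 (hut0.trans hmono)) hfp.le
          _ = usage x τ j l h * f l h := by ring
    · rw [if_neg hc, mul_zero]
      rcases (hf0 l h).eq_or_lt with hz | hfp
      · rw [← hz, mul_zero]
      · obtain ⟨_, hl2, _, hcomp⟩ := hsupp l h hfp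
        have hlh : l < h := by
          rcases hcomp with h1 | h2
          · omega
          · have : (l : ℝ) < h := by linarith
            exact_mod_cast this
        exact mul_nonneg (usage_pos_of_compat x τ j l h hx0 hx1 hl2 hlh hcomp).le hfp.le

end LawDec

end Quant

end Summit.CriticalPhenomena.PercolationContinuityZ3.Theorems
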